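import Summits.QuantumFields.BalabanUV.Beta.FP.CovarianceScalarLetters
import Summits.QuantumFields.BalabanUV.Beta.FP.CoarseSandwichInverseRowSum
import Summits.QuantumFields.BalabanUV.Beta.FP.ScalarTowerBridge
import Literature.MathematicalPhysics.QuantumFieldTheory.Balaban1983to89.B4Thm110ZeroTorus
import Literature.MathematicalPhysics.QuantumFieldTheory.Balaban1983to89.B5Ineq110GpTorus

/-!
# `BalabanUV.Beta.FP.CovarianceRowSumTower` — road «FP» (binder row D1), lane IR-5′, **THE (T0′) SUPPLIER CHAIN, FILE 7: THE `ℓ^∞ → ℓ^∞` LETTER OF THE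
# HARD COVARIANCE `𝒞 = 𝒫G`, UNCONDITIONAL AND VOLUME-UNIFORM ON BAŁABAN's TOWER TORI** — `Σ_j ‖𝒞 i j‖ ≤ C(d, L, a)` for every row `i`, every
# `n = L^K` (`K ≥ 1`) and every torus `M_μ = 2L^m` ((1.115)'s first entry «|GJ| ≤ O(1)|J|» in row-sum currency for the constrained covariance of
# `Beta.FluctuationProjection`); the three scalar `G′` letters of file 4b are READ OFF lit-balaban's B4-Theorem-(1.10)-on-the-torus statements
# (`B4Thm110ZeroTorus.thm110_zero_torus`, `B5Ineq110GpTorus.sup_GrsDstar_torus`) through file 6's dictionary, and `cC` is file 5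

HONEST DEPENDENCY (page 1, mandatory): continuum YM on T⁴ ⇐ BetaPertH ∧ nine spine estimates (0/9 proved); BetaPertH ⇐ (D1) ∧ (D4) ∧
CAP+tail; G-an2-4 gates asym, D1 and NE2/3/4.  HONEST FRAMING (cell contract, verbatim): «discharging `BetaPertH` makes Bałaban's UV
stability UNCONDITIONAL — a real constructive-QFT result; it is NOT the continuum limit and NOT the Clay problem.»  THIS MODULE is bookkeeping BY NAME:
real `ℓ¹`–`ℓ^∞` duality for one row, lit-balaban p38's `thm110_zero_torus` (|G_Kf|, |∂G_Kf| ≤ c₀|f| on the whole torus, volume-uniform) and p37's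
`sup_GrsDstar_torus` (|G_K∂ᵀf| ≤ C|f|), file 6's entry identities, file 5's `exists_rowSum_QGGQ_inv_le`, file 4b's `rowSum_Cov_one_le_of_Gp_letters`.  It cites
nothing as a hypothesis, mints no `Prop`, has no `def`, 0 sorry.  WHAT IT IS NOT: it is NOT (T0′) for the road's `Γ_m = blk (KPerf …) tt` — the road junction
(`‖Γ_road‖ = ½n²·M^{4−D}·‖𝒞‖`, periodisation ∕ de-periodisation, `le_of_tendsto`) is the next file; the volumes are the tower's (`M_μ = 2L^m`, all directions
equal, `L` odd > 1), not every torus; NOT hslice, NOT (ASYMP), NOT D1, NOT BetaPertH, NOT continuum, NOT Clay.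

ABSOLUTE RULE (cell charter, verbatim): «No internally-minted statement may enter as a cited fact. Every hypothesis is either kernel-proved in this
package or a verbatim quotation of a PUBLISHED theorem with page reference. The manuscript(s) under audit are NOT citable for their own disputed
steps — they are the thing under adjudication; programme-internal (2001/route/tribunal) claims are never citable.»

CONTENT.  §1 `rowSum_abs_le_of_mulVec` (real duality), `supN_le_one`; §2 THE THREE TOWER LETTERS: **`exists_rowSum_towerG`** (`Σ_{x′}|G_K(x,x′)| ≤ c₀` and
`Σ_{x′}|(deriv_μ·G_K)(x,x′)| ≤ c₀`), **`exists_rowSum_towerG_derivT`** (`Σ_{x′}|(G_K·deriv_νᵀ)(x,x′)| ≤ C`), constants functions of `d, L, a`; §3 transfer to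
b05 (`rowSum_Gp_eq`, `rowSum_GradOp_Gp_eq`, `rowSum_Gp_GradOpH_eq`); §4 **`exists_rowSum_Cov_tower`**: `∃ C ∀ P (P.d = d+1, P.L = L, 1 ≤ P.K) ∀ i,
Σ_j ‖Cov (nP P) _ (MP P) 1 one_pos i j‖ ≤ C`.
Unit `b2b-balaban-beta-d1-formalise-leaf-05` (gen 19), 2026-08-21; `LEAVES-FP.md` row «(T0′) CHAIN FILE 7».  «(1.115) printed for `G`; the constrained `𝒞`, the
row-sum currency and the proof are ours».
-/

noncomputable section

open scoped BigOperators Matrix ComplexConjugate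

namespace Summit.QuantumFields.BalabanUV.Beta.FP.CovarianceRowSumTower

open Literature.MathematicalPhysics.QuantumFieldTheory.Balaban1983to89
open Literature.MathematicalPhysics.QuantumFieldTheory.Balaban1983to89.B5Prop11Plancherel (Tor fine)
open Literature.MathematicalPhysics.QuantumFieldTheory.Balaban1983to89.B5Action121 (GradOp LapS)
open Literature.MathematicalPhysics.QuantumFieldTheory.Balaban1983to89.B5Block118 (QsOp)
open Literature.MathematicalPhysics.QuantumFieldTheory.Balaban1983to89.B5Hk160Torus (QsAdj)
open Literature.MathematicalPhysics.QuantumFieldTheory.Balaban1983to89.Beta.FluctuationProjection (Cov)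
open Literature.MathematicalPhysics.QuantumFieldTheory.Balaban1983to89.B4TorusKernel (periodConst)
open Literature.MathematicalPhysics.QuantumFieldTheory.Balaban1983to89.B5G183Strip (kappa183)
open Literature.MathematicalPhysics.QuantumFieldTheory.Balaban1983to89.B5G183CovDecay (MD183)
open Literature.MathematicalPhysics.QuantumFieldTheory.Balaban1983to89.B4Sect5Proof (latticeConst)
open Literature.MathematicalPhysics.QuantumFieldTheory.Balaban1983to89.B5SiteBridgeP12 (nP MP eFine one_le_nP)
open Literature.MathematicalPhysics.QuantumFieldTheory.Balaban1983to89.B1RG242Torus (deriv tower α)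
open Literature.MathematicalPhysics.QuantumFieldTheory.Balaban1983to89.B5Ineq137Torus (supN distX distX_nonneg T T_nonneg)
open Literature.MathematicalPhysics.QuantumFieldTheory.Balaban1983to89.B4Thm110ZeroTorus (thm110_zero_torus)
open Literature.MathematicalPhysics.QuantumFieldTheory.Balaban1983to89.B5Ineq110GpTorus (sup_GrsDstar_torus)
open Summit.QuantumFields.BalabanUV.Beta.FP.CovarianceScalarLetters (rowSum_Cov_one_le_of_Gp_letters)
open Summit.QuantumFields.BalabanUV.Beta.FP.CoarseSandwichInverseRowSum (exists_rowSum_QGGQ_inv_le)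
open Summit.QuantumFields.BalabanUV.Beta.FP.ScalarTowerBridge (Gp_bridge GradOp_Gp_bridge Gp_GradOpH_bridge Grs_top_eq_towerG α_top aSeq_bounds)

/-! ## §1 Real `ℓ¹`–`ℓ^∞` duality for one row, and the sup norm of a sign vector -/

/-- [folklore] testing row `x` of a real matrix against its sign vector returns the `ℓ¹` norm of the row; hence a uniform bound on `|(A f)(x)|` over
`|f| ≤ 1` bounds the row sum. -/
theorem rowSum_abs_le_of_mulVec {ι κ : Type*} [Fintype κ] (A : Matrix ι κ ℝ) {C : ℝ} (x : ι)
    (h : ∀ f : κ → ℝ, (∀ j, |f j| ≤ 1) → |(A *ᵥ f) x| ≤ C) : ∑ j, |A x j| ≤ C := by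
  have hs : ∀ j, |(fun j => if 0 ≤ A x j then (1 : ℝ) else -1) j| ≤ 1 := fun j => by
    dsimp only; split_ifs <;> simp
  have h1 := h _ hs
  have heq : (A *ᵥ fun j => if 0 ≤ A x j then (1 : ℝ) else -1) x = ∑ j, |A x j| := by
    simp only [Matrix.mulVec, dotProduct]
    refine Finset.sum_congr rfl fun j _ => ?_
    split_ifs with hj
    · rw [mul_one, abs_of_nonneg hj]
    · rw [mul_neg, mul_one, abs_of_neg (lt_of_not_ge hj)]
  rw [heq, abs_of_nonneg (Finset.sum_nonneg fun j _ => abs_nonneg _)] at h1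
  exact h1

/-- [folklore] the sup norm `supN` of a vector with `|f| ≤ 1` is `≤ 1`. -/
theorem supN_le_one (P : Params) {f : Site P 0 → ℝ} (hf : ∀ j, |f j| ≤ 1) : supN P f ≤ 1 :=
  Finset.sup'_le _ _ fun x _ => hf x

/-! ## §2 The three tower letters (lit-balaban BY NAME) -/

/-- [our bookkeeping] **ROWS OF `G_K` AND OF `∂G_K`** (B4 Theorem (1.10) on the torus, lit-balaban p38's `thm110_zero_torus` with `D = 0`, `F = 1`, tested
against sign vectors): one `c₀(d, L, a)` for every volume and every `K ≥ 1`. -/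
theorem exists_rowSum_towerG (d L : ℕ) (hd : 1 ≤ d) (hL : Odd L ∧ 1 < L) {a : ℝ} (ha : 0 < a) :
    ∃ C : ℝ, 0 ≤ C ∧ ∀ P : Params, P.d = d → P.L = L → 1 ≤ P.K →
      (∀ x, ∑ x', |(tower P a 0).G P.K x x'| ≤ C) ∧
      (∀ (μ : Fin P.d) (x), ∑ x', |(deriv P 0 P.eps μ * (tower P a 0).G P.K) x x'| ≤ C) := by
  obtain ⟨δ₀, c₀, hδ₀, hc₀, h⟩ := thm110_zero_torus d L hd hL ha le_rfl
  refine ⟨c₀, hc₀.le, fun P hPd hPL hK => ⟨fun x => ?_, fun μ x => ?_⟩⟩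
  · refine rowSum_abs_le_of_mulVec _ x fun f hf => ?_
    have := (h P hPd hPL P.K hK le_rfl x f 1 0 hf le_rfl (fun z _ => T_nonneg P 0 x z)).1
    simpa using this
  · refine rowSum_abs_le_of_mulVec _ x fun f hf => ?_
    have := (h P hPd hPL P.K hK le_rfl x f 1 0 hf le_rfl (fun z _ => T_nonneg P 0 x z)).2 μ
    simpa [Matrix.mulVec_mulVec] using this

/-- [our bookkeeping] **ROWS OF `G_K∂ᵀ`** (B5 (1.110)'s «|(G∇*J)(x)|» entry for `G′` on the torus, lit-balaban p37's `sup_GrsDstar_torus` at `k = K`, `t = 0`, tested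
against sign vectors): one `C(d, L, a)` for every volume and every `K ≥ 1`. -/
theorem exists_rowSum_towerG_derivT (d L : ℕ) (hd : 1 ≤ d) (hL : Odd L ∧ 1 < L) {a : ℝ} (ha : 0 < a) :
    ∃ C : ℝ, 0 ≤ C ∧ ∀ P : Params, P.d = d → P.L = L → 1 ≤ P.K →
      ∀ (ν : Fin P.d) (x), ∑ x', |((tower P a 0).G P.K * (deriv P 0 P.eps ν)ᵀ) x x'| ≤ C := by
  obtain ⟨δ, C, hδ, hC, h⟩ := sup_GrsDstar_torus d L hd hL ha le_rfl 0
  refine ⟨C, hC, fun P hPd hPL hK ν x => ?_⟩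
  refine rowSum_abs_le_of_mulVec _ x fun f hf => ?_
  have hcap : P.spacing P.K ^ 2 * (0 : ℝ) ≤ 0 := by rw [mul_zero]
  have h1 := h P hPd hPL P.K hK (Nat.le_add_left P.K P.m) hcap ν f x 0 (fun x' _ => distX_nonneg P P.K x x')
  rw [P.spacing_K, div_one, Grs_top_eq_towerG, mul_zero, neg_zero, Real.exp_zero, mul_one] at h1
  exact h1.trans (mul_le_of_le_one_right hC (supN_le_one P hf))

/-! ## §3 Transfer to b05's torus `Tor (fine n M)`, `n = L^K`, `M_μ = 2L^m` -/

section Transfer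

variable (P : Params) {a : ℝ} (ha : 0 < a) (hK : 1 ≤ P.K)
include ha hK

/-- [our bookkeeping] rows of `G′` are rows of `G_K`. -/
theorem rowSum_Gp_eq (x : Site P 0) :
    ∑ z', ‖(LapS (fine (nP P) (MP P)) (nP P : ℂ) + ((α P a P.K : ℝ) : ℂ) • (QsAdj (nP P) (MP P) * QsOp (nP P) (MP P)))⁻¹ (eFine P x) z'‖
      = ∑ x', |(tower P a 0).G P.K x x'| := by
  rw [← (eFine P).sum_comp]
  exact Finset.sum_congr rfl fun x' _ => by rw [Gp_bridge P ha hK, Complex.norm_real, Real.norm_eq_abs]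

/-- [our bookkeeping] rows of `∂G′` are rows of `deriv·G_K`. -/
theorem rowSum_GradOp_Gp_eq (x : Site P 0) (μ : Fin P.d) :
    ∑ z', ‖(GradOp (fine (nP P) (MP P)) (nP P : ℂ)
        * (LapS (fine (nP P) (MP P)) (nP P : ℂ) + ((α P a P.K : ℝ) : ℂ) • (QsAdj (nP P) (MP P) * QsOp (nP P) (MP P)))⁻¹) (eFine P x, μ) z'‖
      = ∑ x', |(deriv P 0 P.eps μ * (tower P a 0).G P.K) x x'| := by
  rw [← (eFine P).sum_comp]
  exact Finset.sum_congr rfl fun x' _ => by rw [GradOp_Gp_bridge P ha hK, Complex.norm_real, Real.norm_eq_abs]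

/-- [our bookkeeping] rows of `G′∂ᴴ` are sums over `ν` of rows of `G_K·deriv_νᵀ`. -/
theorem rowSum_Gp_GradOpH_eq (x : Site P 0) :
    ∑ j, ‖((LapS (fine (nP P) (MP P)) (nP P : ℂ) + ((α P a P.K : ℝ) : ℂ) • (QsAdj (nP P) (MP P) * QsOp (nP P) (MP P)))⁻¹
        * (GradOp (fine (nP P) (MP P)) (nP P : ℂ))ᴴ) (eFine P x) j‖
      = ∑ ν : Fin P.d, ∑ x', |((tower P a 0).G P.K * (deriv P 0 P.eps ν)ᵀ) x x'| := by
  rw [Fintype.sum_prod_type, Finset.sum_comm]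
  refine Finset.sum_congr rfl fun ν _ => ?_
  rw [← (eFine P).sum_comp]
  exact Finset.sum_congr rfl fun x' _ => by rw [Gp_GradOpH_bridge P ha hK, Complex.norm_real, Real.norm_eq_abs]

end Transfer

/-! ## §4 The hard covariance's row-sum letter on the tower volumes, unconditional -/

/-- [our bookkeeping] **(1.115), FIRST ENTRY, FOR THE HARD COVARIANCE `𝒞 = 𝒫G` IN ROW-SUM CURRENCY — UNCONDITIONAL AND VOLUME-UNIFORM**: for `d`, odd `L > 1`,
`a > 0` there is `C(d, L, a)` such that for every tower volume `P` with `P.d = d + 1`, `P.L = L`, `P.K ≥ 1` (fine torus `Tor (fine (L^K) (2L^m))`, `a = 1` in `Δ_a`)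
and every row `i`, `Σ_j ‖𝒞 i j‖ ≤ C`.  Assembly: file 4b's `rowSum_Cov_one_le_of_Gp_letters` at `b = a_K = B1.aSeq a L K ∈ [a(1 − L⁻²), a]` with
`cG′ = cD′ = c₀` (§2), `cD = (d+1)·C` (§2), `cC` = file 5's constant on `[a(1 − L⁻²), a]`. -/
theorem exists_rowSum_Cov_tower (d L : ℕ) (hL : Odd L ∧ 1 < L) {a : ℝ} (ha : 0 < a) :
    ∃ C : ℝ, ∀ P : Params, P.d = d + 1 → P.L = L → 1 ≤ P.K →
      ∀ i : Tor (fine (nP P) (MP P)) × Fin P.d, ∑ j, ‖Cov (nP P) (one_le_nP P) (MP P) 1 one_pos i j‖ ≤ C := by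
  have hL1 : (1 : ℝ) < L := by exact_mod_cast hL.2
  have hbm : 0 < a * (1 - ((L : ℝ) ^ 2)⁻¹) := by
    have : ((L : ℝ) ^ 2)⁻¹ < 1 := inv_lt_one_of_one_lt₀ (by nlinarith)
    exact mul_pos ha (by linarith)
  obtain ⟨C₁, hC₁, hG⟩ := exists_rowSum_towerG (d + 1) L (Nat.succ_pos d) hL ha
  obtain ⟨C₂, hC₂, hGD⟩ := exists_rowSum_towerG_derivT (d + 1) L (Nat.succ_pos d) hL ha
  obtain ⟨κ, c, hκ, hc, hCC⟩ := exists_rowSum_QGGQ_inv_le (d := d) (a * (1 - ((L : ℝ) ^ 2)⁻¹)) a hbm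
  obtain ⟨c₀, δ₀, hc₀, hδ₀, hCov⟩ := rowSum_Cov_one_le_of_Gp_letters (d := d) (Nn := d) le_rfl
  refine ⟨(2 * d * 2 ^ d * Real.exp (1 / (2 * (d + 1))) * latticeConst (d + 1) (1 / (2 * (d + 1)))
              + (d + 1) * (MD183 (d + 1) d * periodConst (kappa183 (d + 1)) d * latticeConst (d + 1) (kappa183 (d + 1) / (d + 1))))
            + (C₁ * (1 + C₁ * (c⁻¹ * periodConst κ d * latticeConst (d + 1) (κ / (d + 1))) * C₁))
              * ((1 + C₁ * (c⁻¹ * periodConst κ d * latticeConst (d + 1) (κ / (d + 1))) * C₁) * ((((d + 1 : ℕ) : ℕ) : ℝ) * C₂))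
            + (2 * d * 2 ^ d * Real.exp (1 / (2 * (d + 1))) * latticeConst (d + 1) (1 / (2 * (d + 1)))
              + (d + 1) * (MD183 (d + 1) d * periodConst (kappa183 (d + 1)) d * latticeConst (d + 1) (kappa183 (d + 1) / (d + 1))))
              * ((d + 1) * (1 + c₀) * latticeConst (d + 1) δ₀)
              * (2 * d * 2 ^ d * Real.exp (1 / (2 * (d + 1))) * latticeConst (d + 1) (1 / (2 * (d + 1)))
              + (d + 1) * (MD183 (d + 1) d * periodConst (kappa183 (d + 1)) d * latticeConst (d + 1) (kappa183 (d + 1) / (d + 1)))),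
    fun P => ?_⟩
  obtain ⟨Pd, PL, Pm, PK, Phd, PhL⟩ := P
  intro hPd hPL hK
  simp only at hPd hPL hK
  subst Pd
  subst PL
  set P : Params := ⟨d + 1, L, Pm, PK, Phd, PhL⟩ with hP
  intro i
  -- the running constant of the top step and its range
  have hb : 0 < α P a P.K := by rw [α_top]; exact ScalarTowerBridge.aSeq_top_pos P ha hK
  have hb1 : a * (1 - ((L : ℝ) ^ 2)⁻¹) ≤ α P a P.K := by rw [α_top]; exact (aSeq_bounds P ha hK).1
  have hb2 : α P a P.K ≤ a := by rw [α_top]; exact (aSeq_bounds P ha hK).2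
  obtain ⟨hG1, hG2⟩ := hG P rfl rfl hK
  have hGD' := hGD P rfl rfl hK
  -- the four scalar letters on b05's torus
  have hG' : ∀ z, ∑ z', ‖(LapS (fine (nP P) (MP P)) (nP P : ℂ) + ((α P a P.K : ℝ) : ℂ) • (QsAdj (nP P) (MP P) * QsOp (nP P) (MP P)))⁻¹ z z'‖ ≤ C₁ := by
    intro z
    obtain ⟨x, rfl⟩ : ∃ x, eFine P x = z := ⟨(eFine P).symm z, (eFine P).apply_symm_apply z⟩
    rw [rowSum_Gp_eq P ha hK]
    exact hG1 x
  have hD' : ∀ iz : Tor (fine (nP P) (MP P)) × Fin P.d, ∑ z', ‖(GradOp (fine (nP P) (MP P)) (nP P : ℂ)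
      * (LapS (fine (nP P) (MP P)) (nP P : ℂ) + ((α P a P.K : ℝ) : ℂ) • (QsAdj (nP P) (MP P) * QsOp (nP P) (MP P)))⁻¹) iz z'‖ ≤ C₁ := by
    rintro ⟨z, μ⟩
    obtain ⟨x, rfl⟩ : ∃ x, eFine P x = z := ⟨(eFine P).symm z, (eFine P).apply_symm_apply z⟩
    rw [rowSum_GradOp_Gp_eq P ha hK]
    exact hG2 μ x
  have hD : ∀ z, ∑ j, ‖((LapS (fine (nP P) (MP P)) (nP P : ℂ) + ((α P a P.K : ℝ) : ℂ) • (QsAdj (nP P) (MP P) * QsOp (nP P) (MP P)))⁻¹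
      * (GradOp (fine (nP P) (MP P)) (nP P : ℂ))ᴴ) z j‖ ≤ (((d + 1 : ℕ) : ℕ) : ℝ) * C₂ := by
    intro z
    obtain ⟨x, rfl⟩ : ∃ x, eFine P x = z := ⟨(eFine P).symm z, (eFine P).apply_symm_apply z⟩
    rw [rowSum_Gp_GradOpH_eq P ha hK]
    calc ∑ ν : Fin P.d, ∑ x', |((tower P a 0).G P.K * (deriv P 0 P.eps ν)ᵀ) x x'| ≤ ∑ _ν : Fin P.d, C₂ :=
          Finset.sum_le_sum fun ν _ => hGD' ν x
      _ = (((d + 1 : ℕ) : ℕ) : ℝ) * C₂ := by simp [hP]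
  have hC := hCC (nP P) (one_le_nP P) (MP P) (α P a P.K) hb1 hb2
  exact hCov (nP P) (one_le_nP P) (MP P) hb hG' hC hD hD' i

end Summit.QuantumFields.BalabanUV.Beta.FP.CovarianceRowSumTower

end
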